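import Mathlib
import Summits.Ventures.PercRepro2.HalfLA2BMassesA
import Summits.Ventures.PercRepro2.HalfLA1BPoly

/-!
# The masses of the `L`-half for `a₃ ~ {a₁, b}` in the ten cells (blind cell PercRepro2, night-1 g37)

`a₃` adjacent exactly to the root `a₁` (edge `e₁`, weight `r₁`) and to `b` (edge `e₂`, weight `r₂`):
`CaseOne.IsTwoMarkAt ends a₁ b a₃ e₁ e₂` (p1's structure with `o := a₁`); part A (`cellsA1B`, `mass_Q … mass_TbLoU`), part B in `HalfLA1BMassesB`.  With `e₁` open `a₃ ∈ L` on `Q₀`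
(so `T = PD = ∅`), with `e₂` open `a₃` is a leaf at `b`, with both open `b`'s cluster joins `L` through
`a₃` and `Q` becomes `Q₀ ∩ {b ∉ H}`.  The cells are `HalfLA2B.cells10Of` (the same ten base probabilities
with `(e₁, e₂)` in place of the edges of `a₃`); the masses are the polynomials of `HalfLA1BPoly`.
-/

namespace Summit.Ventures.PercRepro2

namespace HalfLA1B

open CaseOne HalfLTwoMark HalfLA2B

section Masses

variable {V : Type*} {E : Type*} [Fintype E] [DecidableEq E] {R : Type*} [CommRing R]
variable {ends : E → Sym2 V} {o a₃ b : V} {e₁ e₂ : E}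

/-- The ten cells (the `Cells10` of `HalfLA1BPoly` from the base probabilities of `HalfLA2B.cells10Of`). -/
noncomputable def cellsA1B (p : E → R) (ends : E → Sym2 V) (o a₁ a₂ b : V) (e₁ e₂ : E) : Cells10 R :=
  ⟨(cells10Of p ends o a₁ a₂ b e₁ e₂).LL, (cells10Of p ends o a₁ a₂ b e₁ e₂).LH,
    (cells10Of p ends o a₁ a₂ b e₁ e₂).LN, (cells10Of p ends o a₁ a₂ b e₁ e₂).HL,
    (cells10Of p ends o a₁ a₂ b e₁ e₂).HH, (cells10Of p ends o a₁ a₂ b e₁ e₂).HN,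
    (cells10Of p ends o a₁ a₂ b e₁ e₂).NL, (cells10Of p ends o a₁ a₂ b e₁ e₂).NH,
    (cells10Of p ends o a₁ a₂ b e₁ e₂).NNs, (cells10Of p ends o a₁ a₂ b e₁ e₂).NNd⟩

/-- **`P(Q)`** for `a₃ ~ {a₁, b}`: `M − r₁ r₂ · P(Q₀, b ∈ H)`. -/
theorem mass_Q (p : E → R) {a₁ a₂ : V} (h : IsTwoMarkAt ends a₁ b a₃ e₁ e₂) (h2 : a₂ ≠ a₃) :
    prob p (connEvent ends a₁ a₂)ᶜ = mQ (p e₁) (p e₂) (cellsA1B p ends o a₁ a₂ b e₁ e₂) := by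
  set p00 := Function.update (Function.update p e₁ 0) e₂ 0 with hp00
  have h1 : a₁ ≠ a₃ := h.ne_o
  have key := prob_twoPin p h.ne (connEvent ends a₁ a₂)ᶜ
    ((connEvent ends a₁ a₂)ᶜ ∩ (connEvent ends a₂ b)ᶜ)
    (connEvent ends a₁ a₂)ᶜ (connEvent ends a₁ a₂)ᶜ (connEvent ends a₁ a₂)ᶜ ?_ ?_ ?_ ?_
  · rw [key]
    unfold mQ cellsA1B cells10Of
    dsimp only
    rw [← hp00]
    have c := prob_inter_add_prob_inter_compl p00 (connEvent ends a₁ a₂)ᶜ (connEvent ends a₂ b)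
    have so := split_o p00 ends o a₁ a₂ (connEvent ends a₂ b)
    have tot := total_cells p00 ends o b a₁ a₂
    have nn := split_NN p00 ends o a₁ a₂ b
    linear_combination (p e₁ * p e₂) * (c - so) + tot + nn
  · intro ω ho hb
    rw [openCC_tt ho hb]
    simp only [Set.mem_compl_iff, Set.mem_inter_iff, mem_connEvent]
    rw [conn_both_iff h ω h1 h2, base2_eq_self ho hb, conn_comm_iff ω b a₂]
    have haa := conn_refl ends ω a₁
    tauto
  · intro ω ho hb
    rw [openCC_tf h.ne ho hb]
    simp only [Set.mem_compl_iff, mem_connEvent]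
    rw [conn_open_o_iff h ω h1 h2, base2_eq_self ho hb]
  · intro ω ho hb
    rw [openCC_ft ho hb]
    simp only [Set.mem_compl_iff, mem_connEvent]
    rw [conn_open_b_iff h ω h1 h2, base2_eq_self ho hb]
  · intro ω ho hb
    rw [openCC_ff ho hb, base2_eq_self ho hb]

/-- **`P(Q, b ∈ L)`** for `a₃ ~ {a₁, b}`: `(1 − r₁ r₂) P(Q₀, bL) + r₁ r₂ P(Q₀, b ∉ H)`. -/
theorem mass_bL (p : E → R) {a₁ a₂ : V} (h : IsTwoMarkAt ends a₁ b a₃ e₁ e₂) (h2 : a₂ ≠ a₃) :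
    prob p ((connEvent ends a₁ a₂)ᶜ ∩ connEvent ends a₁ b) =
      mbL (p e₁) (p e₂) (cellsA1B p ends o a₁ a₂ b e₁ e₂) := by
  set p00 := Function.update (Function.update p e₁ 0) e₂ 0 with hp00
  have h1 : a₁ ≠ a₃ := h.ne_o
  have key := prob_twoPin p h.ne ((connEvent ends a₁ a₂)ᶜ ∩ connEvent ends a₁ b)
    ((connEvent ends a₁ a₂)ᶜ ∩ (connEvent ends a₂ b)ᶜ)
    ((connEvent ends a₁ a₂)ᶜ ∩ connEvent ends a₁ b) ((connEvent ends a₁ a₂)ᶜ ∩ connEvent ends a₁ b)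
    ((connEvent ends a₁ a₂)ᶜ ∩ connEvent ends a₁ b) ?_ ?_ ?_ ?_
  · rw [key]
    unfold mbL cellsA1B cells10Of
    dsimp only
    rw [← hp00]
    have c := prob_inter_add_prob_inter_compl p00 (connEvent ends a₁ a₂)ᶜ (connEvent ends a₂ b)
    have so := split_o p00 ends o a₁ a₂ (connEvent ends a₂ b)
    have so1 := split_o p00 ends o a₁ a₂ (connEvent ends a₁ b)
    have tot := total_cells p00 ends o b a₁ a₂
    have nn := split_NN p00 ends o a₁ a₂ b
    linear_combination (p e₁ * p e₂) * (c - so + tot + nn) + (1 - p e₁ * p e₂) * so1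
  · intro ω ho hb
    rw [openCC_tt ho hb]
    simp only [Set.mem_compl_iff, Set.mem_inter_iff, mem_connEvent]
    rw [conn_both_iff h ω h1 h2, conn_both_iff h ω h1 h.ne_b, base2_eq_self ho hb, conn_comm_iff ω b a₂]
    have haa := conn_refl ends ω a₁
    have hbb := conn_refl ends ω b
    tauto
  · intro ω ho hb
    rw [openCC_tf h.ne ho hb]
    simp only [Set.mem_compl_iff, Set.mem_inter_iff, mem_connEvent]
    rw [conn_open_o_iff h ω h1 h2, conn_open_o_iff h ω h1 h.ne_b, base2_eq_self ho hb]
  · intro ω ho hb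
    rw [openCC_ft ho hb]
    simp only [Set.mem_compl_iff, Set.mem_inter_iff, mem_connEvent]
    rw [conn_open_b_iff h ω h1 h2, conn_open_b_iff h ω h1 h.ne_b, base2_eq_self ho hb]
  · intro ω ho hb
    rw [openCC_ff ho hb, base2_eq_self ho hb]

/-- **`P(T)`** for `a₃ ~ {a₁, b}`: `(1 − r₁) r₂ · P(Q₀, b ∈ H)`. -/
theorem mass_T (p : E → R) {a₁ a₂ : V} (h : IsTwoMarkAt ends a₁ b a₃ e₁ e₂) (h2 : a₂ ≠ a₃) :
    prob p ((connEvent ends a₁ a₂)ᶜ ∩ connEvent ends a₂ a₃) =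
      mT (p e₁) (p e₂) (cellsA1B p ends o a₁ a₂ b e₁ e₂) := by
  set p00 := Function.update (Function.update p e₁ 0) e₂ 0 with hp00
  have h1 : a₁ ≠ a₃ := h.ne_o
  have key := prob_twoPin p h.ne ((connEvent ends a₁ a₂)ᶜ ∩ connEvent ends a₂ a₃)
    ∅ ∅ ((connEvent ends a₁ a₂)ᶜ ∩ connEvent ends a₂ b) ∅ ?_ ?_ ?_ ?_
  · rw [key]
    unfold mT cellsA1B cells10Of
    dsimp only
    rw [← hp00, prob_empty]
    have so := split_o p00 ends o a₁ a₂ (connEvent ends a₂ b)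
    linear_combination ((1 - p e₁) * p e₂) * so
  · intro ω ho hb
    rw [openCC_tt ho hb]
    simp only [Set.mem_compl_iff, Set.mem_inter_iff, mem_connEvent, Set.mem_empty_iff_false, iff_false]
    rw [conn_both_iff h ω h1 h2, conn_both_a3_iff h ω h2, base2_eq_self ho hb, conn_comm_iff ω b a₂,
      conn_comm_iff ω a₂ a₁]
    have haa := conn_refl ends ω a₁
    tauto
  · intro ω ho hb
    rw [openCC_tf h.ne ho hb]
    simp only [Set.mem_compl_iff, Set.mem_inter_iff, mem_connEvent, Set.mem_empty_iff_false, iff_false]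
    rw [conn_open_o_iff h ω h1 h2, conn_open_o_a3_iff h ω h2, base2_eq_self ho hb]
    exact fun hc => hc.1 (conn_symm hc.2)
  · intro ω ho hb
    rw [openCC_ft ho hb]
    simp only [Set.mem_compl_iff, Set.mem_inter_iff, mem_connEvent]
    rw [conn_open_b_iff h ω h1 h2, conn_open_b_a3_iff h ω h2, base2_eq_self ho hb]
  · intro ω ho hb
    rw [openCC_ff ho hb]
    simp only [Set.mem_compl_iff, Set.mem_inter_iff, mem_connEvent, Set.mem_empty_iff_false,
      iff_false, not_and]
    exact fun _ hc => not_conn_base2 h ω h2 hc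

/-- **`P(T, b ∈ L) = 0`** for `a₃ ~ {a₁, b}`. -/
theorem mass_TbL (p : E → R) {a₁ a₂ : V} (h : IsTwoMarkAt ends a₁ b a₃ e₁ e₂) (h2 : a₂ ≠ a₃) :
    prob p ((connEvent ends a₁ a₂)ᶜ ∩ connEvent ends a₂ a₃ ∩ connEvent ends a₁ b) =
      mTbL (p e₁) (p e₂) (cellsA1B p ends o a₁ a₂ b e₁ e₂) := by
  have h1 : a₁ ≠ a₃ := h.ne_o
  have key := prob_twoPin p h.ne ((connEvent ends a₁ a₂)ᶜ ∩ connEvent ends a₂ a₃ ∩ connEvent ends a₁ b)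
    ∅ ∅ ∅ ∅ ?_ ?_ ?_ ?_
  · rw [key]
    unfold mTbL
    rw [prob_empty]
    ring
  · intro ω ho hb
    rw [openCC_tt ho hb]
    simp only [Set.mem_compl_iff, Set.mem_inter_iff, mem_connEvent, Set.mem_empty_iff_false, iff_false]
    rw [conn_both_iff h ω h1 h2, conn_both_a3_iff h ω h2, conn_both_iff h ω h1 h.ne_b,
      base2_eq_self ho hb, conn_comm_iff ω b a₂, conn_comm_iff ω a₂ a₁]
    have haa := conn_refl ends ω a₁
    intro hc
    have hc1 := hc.1
    clear hc
    tauto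
  · intro ω ho hb
    rw [openCC_tf h.ne ho hb]
    simp only [Set.mem_compl_iff, Set.mem_inter_iff, mem_connEvent, Set.mem_empty_iff_false, iff_false]
    rw [conn_open_o_iff h ω h1 h2, conn_open_o_a3_iff h ω h2, conn_open_o_iff h ω h1 h.ne_b,
      base2_eq_self ho hb]
    exact fun hc => hc.1.1 (conn_symm hc.1.2)
  · intro ω ho hb
    rw [openCC_ft ho hb]
    simp only [Set.mem_compl_iff, Set.mem_inter_iff, mem_connEvent, Set.mem_empty_iff_false, iff_false]
    rw [conn_open_b_iff h ω h1 h2, conn_open_b_a3_iff h ω h2, conn_open_b_iff h ω h1 h.ne_b,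
      base2_eq_self ho hb]
    exact fun hc => hc.1.1 (conn_trans hc.2 (conn_symm hc.1.2))
  · intro ω ho hb
    rw [openCC_ff ho hb]
    simp only [Set.mem_compl_iff, Set.mem_inter_iff, mem_connEvent, Set.mem_empty_iff_false, iff_false]
    exact fun hc => not_conn_base2 h ω h2 hc.1.2

/-- **`P(T, b ∈ L, o ∈ U) = 0`** for `a₃ ~ {a₁, b}`. -/
theorem mass_TbLoU (p : E → R) {a₁ a₂ : V} (h : IsTwoMarkAt ends a₁ b a₃ e₁ e₂) (h2 : a₂ ≠ a₃) :
    prob p ((connEvent ends a₁ a₂)ᶜ ∩ connEvent ends a₂ a₃ ∩ connEvent ends a₁ b ∩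
        (connEvent ends a₁ o ∪ connEvent ends a₂ o)) =
      mTbLoU (p e₁) (p e₂) (cellsA1B p ends o a₁ a₂ b e₁ e₂) := by
  have h1 : a₁ ≠ a₃ := h.ne_o
  have key := prob_twoPin p h.ne ((connEvent ends a₁ a₂)ᶜ ∩ connEvent ends a₂ a₃ ∩ connEvent ends a₁ b ∩
        (connEvent ends a₁ o ∪ connEvent ends a₂ o)) ∅ ∅ ∅ ∅ ?_ ?_ ?_ ?_
  · rw [key]
    unfold mTbLoU
    rw [prob_empty]
    ring
  · intro ω ho hb
    rw [openCC_tt ho hb]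
    simp only [Set.mem_compl_iff, Set.mem_inter_iff, Set.mem_union, mem_connEvent,
      Set.mem_empty_iff_false, iff_false]
    rw [conn_both_iff h ω h1 h2, conn_both_a3_iff h ω h2, conn_both_iff h ω h1 h.ne_b,
      base2_eq_self ho hb, conn_comm_iff ω b a₂, conn_comm_iff ω a₂ a₁]
    have haa := conn_refl ends ω a₁
    intro hc
    have hc1 := hc.1.1
    clear hc
    tauto
  · intro ω ho hb
    rw [openCC_tf h.ne ho hb]
    simp only [Set.mem_compl_iff, Set.mem_inter_iff, Set.mem_union, mem_connEvent,
      Set.mem_empty_iff_false, iff_false]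
    rw [conn_open_o_iff h ω h1 h2, conn_open_o_a3_iff h ω h2, conn_open_o_iff h ω h1 h.ne_b,
      base2_eq_self ho hb]
    exact fun hc => hc.1.1.1 (conn_symm hc.1.1.2)
  · intro ω ho hb
    rw [openCC_ft ho hb]
    simp only [Set.mem_compl_iff, Set.mem_inter_iff, Set.mem_union, mem_connEvent,
      Set.mem_empty_iff_false, iff_false]
    rw [conn_open_b_iff h ω h1 h2, conn_open_b_a3_iff h ω h2, conn_open_b_iff h ω h1 h.ne_b,
      base2_eq_self ho hb]
    exact fun hc => hc.1.1.1 (conn_trans hc.1.2 (conn_symm hc.1.1.2))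
  · intro ω ho hb
    rw [openCC_ff ho hb]
    simp only [Set.mem_compl_iff, Set.mem_inter_iff, Set.mem_union, mem_connEvent,
      Set.mem_empty_iff_false, iff_false]
    exact fun hc => not_conn_base2 h ω h2 hc.1.1.2

end Masses

end HalfLA1B

end Summit.Ventures.PercRepro2
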